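import Literature.AnabelianGeometry.EtaleTheta.SettingModelLevelKernels
import HarnessLib

/-!
# A FINER model of the [EtTh] §1 root — the theta-quotient kernels `KTheta₂ ⊆ KEll₂` in level coordinates

Mochizuki, *The étale theta function …*, Publ. RIMS **45** (2009) [EtTh], §1, PRIMS PDF p. 12
[cite: MochizukiEtTh2009, §1 p.12]: "`Δ^Θ_X := Δ_X/[Δ_X,[Δ_X,Δ_X]]`", "`Δ_Θ` (`≅ Ẑ(1)`)". Layer L2 of the
abc-iut cell (seat abc-iut-L6-d6 gen 4; abc-iut-L2-lead gen 3 RULINGS #13 R100, file F1b (part 2) of the R78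
«χ-twisted root model» cluster). PROOF-ONLY sequel of `SettingModelLevelKernels.lean`, applied to
abc-iut-L2-t1's finer model `curve₂` (`SettingModel2Curve/2Theta.lean`: `Π^tp_X = (F̂₂ ×_Ẑ ℤ) × Γ`,
`Π_X = F̂₂ × Γ̂`, kernels `KEll₂ ⊇ KTheta₂` pulled back from the closures of `[Δ_X,Δ_X]`, `[[Δ_X,Δ_X],Δ_X]`):

* `mem_KTheta₂_iff` — `g ∈ KTheta₂ ↔ (∀ N, ĥ_N(g) = 1) ∧ g_Γ = 1`;
* `mem_KEll₂_iff` — `g ∈ KEll₂ ↔ (∀ N, ĥ_N(g)` has `x = y = 0) ∧ g_Γ = 1`;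
* `hHat_eq_mk_z_of_mem_KEll₂`, **`inv_mul_mem_KTheta₂_iff_forall_hHat_z_eq`** — on `KEll₂` the `z`-coordinates
  `(ĥ_N ·).z ∈ ℤ/N` are well defined modulo `KTheta₂` and JOINTLY INJECTIVE: they coordinatise
  `Δ_Θ = KEll₂/KTheta₂ ↪ lim_N ℤ/N = Ẑ` level by level (the abstract `Δ_Θ ≃* Ẑ` is abc-iut-L2-d1's
  `IsEtThOrigin.nonempty_deltaTheta_mulEquiv_zHat` with abc-iut-L2-t1's `hYcl_model₂`; what the twisted model
  adds is that the Galois action on these coordinates is the cyclotomic character).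

Classical; nothing of [EtTh] is asserted; a model is consistency evidence only; no side is taken on
[IUTchIII] Cor. 3.12. No definitions, no instances, no Prop facts.
-/

noncomputable section

namespace Literature.AnabelianGeometry.EtaleTheta.SettingModel

open Literature.AnabelianGeometry.SemiGraphs
open CategoryTheory Function
open scoped commutatorElement Pointwise

variable (p : ℕ) [Fact p.Prime]

/-- `F̂₂ × 1` is closed in `Π_X = F̂₂ × Γ̂`. [folklore] -/
private theorem isClosed_top_prod_bot' :
    IsClosed (((⊤ : Subgroup F₂hatT).prod (⊥ : Subgroup (GamHatT p)) : Subgroup (PiHt p)) : Set (PiHt p)) := by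
  have : (((⊤ : Subgroup F₂hatT).prod (⊥ : Subgroup (GamHatT p)) : Subgroup (PiHt p)) : Set (PiHt p)) =
      Set.univ ×ˢ {1} := by
    ext z; simp [Subgroup.mem_prod, Subgroup.mem_bot]
  rw [this]
  exact isClosed_univ.prod isClosed_singleton

/-- A continuous homomorphism maps the closure of a subgroup into the closure of its image. [folklore] -/
private theorem map_mem_topologicalClosure_map' {G G' : Type*} [Group G] [TopologicalSpace G]
    [IsTopologicalGroup G] [Group G'] [TopologicalSpace G'] [IsTopologicalGroup G'] (f : G →* G')
    (hf : Continuous f) {H : Subgroup G} {x : G} (hx : x ∈ H.topologicalClosure) :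
    f x ∈ (H.map f).topologicalClosure := by
  have hx' : x ∈ closure (H : Set G) := by
    have : x ∈ (H.topologicalClosure : Set G) := hx
    rwa [Subgroup.topologicalClosure_coe] at this
  have h2 := image_closure_subset_closure_image hf ⟨x, hx', rfl⟩
  show f x ∈ ((H.map f).topologicalClosure : Set G')
  rw [Subgroup.topologicalClosure_coe, Subgroup.coe_map]
  exact h2

/-- The first projection `F̂₂ × Γ̂ → F̂₂` identifies `[[Δ_X,Δ_X],Δ_X]⁻` (`Δ_X = F̂₂ × 1`) with
`[[F̂₂,F̂₂],F̂₂]⁻ × 1`. [cite: MochizukiEtTh2009, §1 p.12] -/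
private theorem mem_closure_deltaHat₃_iff (y : PiHt p) :
    y ∈ (⁅⁅(curve₂ p).DeltaHat, (curve₂ p).DeltaHat⁆, (curve₂ p).DeltaHat⁆).topologicalClosure ↔
      y.1 ∈ (⁅⁅(⊤ : Subgroup F₂hatT), (⊤ : Subgroup F₂hatT)⁆, (⊤ : Subgroup F₂hatT)⁆).topologicalClosure ∧
        y.2 = 1 := by
  haveI := deltaHat₂_normal p
  -- abbreviations for the two triple commutators
  set S : Subgroup F₂hatT := ⁅⁅(⊤ : Subgroup F₂hatT), (⊤ : Subgroup F₂hatT)⁆, (⊤ : Subgroup F₂hatT)⁆ with hS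
  set S₂ : Subgroup (PiHt p) := ⁅⁅(curve₂ p).DeltaHat, (curve₂ p).DeltaHat⁆, (curve₂ p).DeltaHat⁆ with hS₂
  have hfst : S₂.map (MonoidHom.fst F₂hatT (GamHatT p)) ≤ S := by
    rw [hS₂, hS, Subgroup.map_commutator, Subgroup.map_commutator]
    exact Subgroup.commutator_mono (Subgroup.commutator_mono le_top le_top) le_top
  have hinl : S.map (MonoidHom.inl F₂hatT (GamHatT p)) ≤ S₂ := by
    rw [hS₂, hS, Subgroup.map_commutator, Subgroup.map_commutator]
    have htop : (⊤ : Subgroup F₂hatT).map (MonoidHom.inl F₂hatT (GamHatT p)) ≤ (curve₂ p).DeltaHat := by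
      rintro _ ⟨x, -, rfl⟩
      exact mk_one_mem_deltaHat₂ p x
    exact Subgroup.commutator_mono (Subgroup.commutator_mono htop htop) htop
  constructor
  · intro hy
    have h2 : y.2 = 1 := snd_eq_one_of_mem_deltaHat₂ p
      ((Subgroup.topologicalClosure_minimal _ (Subgroup.commutator_le_right _ (curve₂ p).DeltaHat)
        (by rw [deltaHat₂_eq]; exact isClosed_top_prod_bot' p)) hy)
    refine ⟨?_, h2⟩
    have h1 := map_mem_topologicalClosure_map' (MonoidHom.fst F₂hatT (GamHatT p)) continuous_fst hy
    exact Subgroup.topologicalClosure_mono hfst h1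
  · rintro ⟨h1, h2⟩
    have hcont : Continuous (MonoidHom.inl F₂hatT (GamHatT p)) :=
      continuous_id.prodMk continuous_const
    have h4 := map_mem_topologicalClosure_map' (MonoidHom.inl F₂hatT (GamHatT p)) hcont h1
    have hy : y = MonoidHom.inl F₂hatT (GamHatT p) y.1 := by
      rw [MonoidHom.inl_apply]
      exact Prod.ext rfl h2
    rw [hy]
    exact Subgroup.topologicalClosure_mono hinl h4

/-- The first projection identifies `[Δ_X,Δ_X]⁻` (`Δ_X = F̂₂ × 1`) with `[F̂₂,F̂₂]⁻ × 1`.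
[cite: MochizukiEtTh2009, §1 p.12] -/
private theorem mem_closure_deltaHat₂_iff (y : PiHt p) :
    y ∈ (⁅(curve₂ p).DeltaHat, (curve₂ p).DeltaHat⁆).topologicalClosure ↔
      y.1 ∈ (⁅(⊤ : Subgroup F₂hatT), (⊤ : Subgroup F₂hatT)⁆).topologicalClosure ∧ y.2 = 1 := by
  haveI := deltaHat₂_normal p
  set S : Subgroup F₂hatT := ⁅(⊤ : Subgroup F₂hatT), (⊤ : Subgroup F₂hatT)⁆ with hS
  set S₂ : Subgroup (PiHt p) := ⁅(curve₂ p).DeltaHat, (curve₂ p).DeltaHat⁆ with hS₂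
  have hfst : S₂.map (MonoidHom.fst F₂hatT (GamHatT p)) ≤ S := by
    rw [hS₂, hS, Subgroup.map_commutator]
    exact Subgroup.commutator_mono le_top le_top
  have hinl : S.map (MonoidHom.inl F₂hatT (GamHatT p)) ≤ S₂ := by
    rw [hS₂, hS, Subgroup.map_commutator]
    have htop : (⊤ : Subgroup F₂hatT).map (MonoidHom.inl F₂hatT (GamHatT p)) ≤ (curve₂ p).DeltaHat := by
      rintro _ ⟨x, -, rfl⟩
      exact mk_one_mem_deltaHat₂ p x
    exact Subgroup.commutator_mono htop htop
  constructor
  · intro hy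
    have h2 : y.2 = 1 := snd_eq_one_of_mem_deltaHat₂ p (commutatorClosure_le_deltaHat₂ p hy)
    refine ⟨?_, h2⟩
    have h1 := map_mem_topologicalClosure_map' (MonoidHom.fst F₂hatT (GamHatT p)) continuous_fst hy
    exact Subgroup.topologicalClosure_mono hfst h1
  · rintro ⟨h1, h2⟩
    have hcont : Continuous (MonoidHom.inl F₂hatT (GamHatT p)) :=
      continuous_id.prodMk continuous_const
    have h4 := map_mem_topologicalClosure_map' (MonoidHom.inl F₂hatT (GamHatT p)) hcont h1
    have hy : y = MonoidHom.inl F₂hatT (GamHatT p) y.1 := by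
      rw [MonoidHom.inl_apply]
      exact Prod.ext rfl h2
    rw [hy]
    exact Subgroup.topologicalClosure_mono hinl h4

/-- **`KEll₂` in coordinates**: `g ∈ Ker(Π^tp_X ↠ (Π^tp_X)^ell)` iff its arithmetic component is trivial and
the `x`,`y`-coordinates of every `ĥ_N` vanish on its `F̂₂`-component. [cite: MochizukiEtTh2009, §1 p.12] -/
theorem mem_KEll₂_iff (g : PiTp₂ p) :
    g ∈ KEll₂ p ↔ (∀ N : ℕ+, (hHat N (g.1 : F₂hatT × Multiplicative ℤ).1).x = 0 ∧
      (hHat N (g.1 : F₂hatT × Multiplicative ℤ).1).y = 0) ∧ g.2 = 1 := by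
  have h0 : g ∈ KEll₂ p ↔ (curve₂ p).toHat g ∈
      (⁅(curve₂ p).DeltaHat, (curve₂ p).DeltaHat⁆).topologicalClosure := Iff.rfl
  rw [h0, mem_closure_deltaHat₂_iff, mem_closure_commutator₂_iff_forall_hHat, toHat₂_apply]
  refine and_congr Iff.rfl ⟨fun h => ?_, fun h => ?_⟩
  · exact etaGam_injective p (by rw [map_one]; exact h)
  · show etaGam p g.2 = 1
    rw [h, map_one]

/-- **`KTheta₂` in coordinates**: `g ∈ Ker(Π^tp_X ↠ (Π^tp_X)^Θ)` iff its arithmetic component is trivial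
and its `F̂₂`-component dies under every level map `ĥ_N`. [cite: MochizukiEtTh2009, §1 p.12] -/
theorem mem_KTheta₂_iff (g : PiTp₂ p) :
    g ∈ KTheta₂ p ↔ (∀ N : ℕ+, hHat N (g.1 : F₂hatT × Multiplicative ℤ).1 = 1) ∧ g.2 = 1 := by
  have h0 : g ∈ KTheta₂ p ↔ (curve₂ p).toHat g ∈
      (⁅⁅(curve₂ p).DeltaHat, (curve₂ p).DeltaHat⁆, (curve₂ p).DeltaHat⁆).topologicalClosure := Iff.rfl
  rw [h0, mem_closure_deltaHat₃_iff, mem_closure_commutator₃_iff_forall_hHat, toHat₂_apply]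
  refine and_congr Iff.rfl ⟨fun h => ?_, fun h => ?_⟩
  · exact etaGam_injective p (by rw [map_one]; exact h)
  · show etaGam p g.2 = 1
    rw [h, map_one]

/-- On `KEll₂` the level maps take values on the `z`-axis: `ĥ_N(g) = (0, 0, z_N(g))`.
[cite: MochizukiEtTh2009, §1 p.12] -/
theorem hHat_eq_mk_z_of_mem_KEll₂ {g : PiTp₂ p} (hg : g ∈ KEll₂ p) (N : ℕ+) :
    hHat N (g.1 : F₂hatT × Multiplicative ℤ).1 = ⟨0, 0, (hHat N (g.1 : F₂hatT × Multiplicative ℤ).1).z⟩ := by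
  obtain ⟨hxy, -⟩ := (mem_KEll₂_iff p g).mp hg
  obtain ⟨hx, hy⟩ := hxy N
  ext <;> simp [hx, hy]

/-- **The `z`-coordinates coordinatise `Δ_Θ = KEll₂/KTheta₂`**: for `a, b ∈ KEll₂`, `a⁻¹b ∈ KTheta₂` iff
`ĥ_N(a)` and `ĥ_N(b)` have the same `z`-coordinate for every `N` — the level-wise `z`-coordinate is well defined
on `Δ_Θ` and JOINTLY INJECTIVE (`Δ_Θ ↪ lim_N ℤ/N = Ẑ`; "`Δ_Θ` (`≅ Ẑ(1)`)", p. 12).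
[cite: MochizukiEtTh2009, §1 p.12] -/
theorem inv_mul_mem_KTheta₂_iff_forall_hHat_z_eq {a b : PiTp₂ p} (ha : a ∈ KEll₂ p) (hb : b ∈ KEll₂ p) :
    a⁻¹ * b ∈ KTheta₂ p ↔ ∀ N : ℕ+,
      (hHat N (a.1 : F₂hatT × Multiplicative ℤ).1).z = (hHat N (b.1 : F₂hatT × Multiplicative ℤ).1).z := by
  obtain ⟨-, ha2⟩ := (mem_KEll₂_iff p a).mp ha
  obtain ⟨-, hb2⟩ := (mem_KEll₂_iff p b).mp hb
  rw [mem_KTheta₂_iff]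
  have h2 : (a⁻¹ * b).2 = 1 := by simp [ha2, hb2]
  simp only [h2, and_true]
  refine forall_congr' fun N => ?_
  have hval : ((a⁻¹ * b).1 : F₂hatT × Multiplicative ℤ).1 =
      ((a.1 : F₂hatT × Multiplicative ℤ).1)⁻¹ * (b.1 : F₂hatT × Multiplicative ℤ).1 := rfl
  rw [hval, map_mul, map_inv, hHat_eq_mk_z_of_mem_KEll₂ p ha, hHat_eq_mk_z_of_mem_KEll₂ p hb, Heis.ext_iff]
  simp only [Heis.mul_x, Heis.mul_y, Heis.mul_z, Heis.inv_x, Heis.inv_y, Heis.inv_z, Heis.one_x, Heis.one_y,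
    Heis.one_z, neg_zero, add_zero, mul_zero, true_and]
  constructor
  · intro h; linear_combination -h
  · intro h; rw [h]; ring

end Literature.AnabelianGeometry.EtaleTheta.SettingModel

end
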